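/-
Copyright (c) 2026 the pub-hodgecm-mathlib formalisation cell (harness21).  Prover seat hodgecm-mathlib-F0P2-p09 (g2), Track B «K2-LIT»,
#184♮ = hLiu418 = `stmt-HodgeConjecture-24832`; socket #41, KIND 1 (K1-b♮), organ (K1b-W) ∕ (ρ·), brick (ρ3) EDITION 2 «GENERAL PLACE, ENTRYWISE» for (P-supp-lat) —
LEAD F0P6-plan (g14) BATCH #180 (3) «second file of LH4-p18's cut», LH4-p18 (g3) 2026-09-05T00:01:54Z «(i) PLEASE»; desk K2Liu-p14 (g4), box K2Liu-audit1 (g2).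
A SIBLING FILE, not an append: ★ p863078 `K2LiuKindOneLineCharacterBoundTwo` has 363 lines and the tree's 400-line cap forbids the 150-line append.
THEOREMS ONLY (no `def`, no `instance`, no notation, no named-fact hypothesis, no `sorry`).
-/
import Summits.HodgeConjecture.HodgeConjecture.Theorems.K2LiuKindOneLineCharacterBoundTwo   -- ★ (ρ3) §1 scalar engine, §2 test matrices ∕ `skew_entries` ∕ `trace_mul_test`, §3 good place
import HarnessLib

/-!
# Crux `HLiu418`, socket #41, KIND 1, brick (ρ3) EDITION 2: THE ENTRYWISE CHARACTER BOUND AT `n = 2` AT A GENERAL PLACE — `|2|_w·|δ|_w·|S_{ab}|_w ≤ max(|δ|_w,1)·exp(e(w|v)(N − d))`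

Cell `hodgecm-mathlib`, crux item hLiu418 = `stmt-HodgeConjecture-24832` (helper lane `--supports … --as helper`, count-neutral), route of record `HCCMUnconditional`;
squad K2 ∕ K2Liu (L1), road `K2_Liu`, socket #41, KIND 1, organ (K1b-W) ∕ (ρ·) (desk K2Liu-p14 (g4)), brick (ρ3) «the index `S` of a unipotent Fourier coefficient killed by
the deep test unipotents lies in the dual lattice», EDITION 2 = the GENERAL-PLACE ENTRYWISE form asked by the (P-supp-lat) payer LH4-p18 (g3) for the finitely many BAD
places `w ∣ v` of `L` (ramified `v`, `|2|_w < 1`, `|δ|_w ≠ 1`): ★ (ρ3) `K2LiuKindOneLineCharacterBoundTwo` §3 `valued_entry_le_exp_of_forall_test` is the GOOD-PLACE head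
(`hunr h2w hδw`), §1 `valued_mul_le_of_forall_addChar_trace_eq_one` the general-place SCALAR engine; this file runs §3's entry-by-entry reading of the four elementary skew
tests (`X₀₁(z)`, `X₁₀(z)`, `z·E₀₀`, `z·E₁₁`) on the general engine.  MATHEMATICS ([Shimura1997, §18.4 Prop. 18.14]: the Fourier index of a coefficient invariant under a
lattice of unipotents lies in the dual lattice; [Tate1950, §2.2] ∕ [BushnellHenniart2006, §1.7]: `{y : ψ(xy) = 1 ∀ x ∈ 𝔭^N} = 𝔭^{d−N}` for `ψ` of conductor exponent `d`;
[WeilBNT1967, Ch. VIII §4]: the local trace pairing `L_w × L⁺_v → L⁺_v` and its unit defects `|2|_w`, `|δ|_w` off the different): nothing in §3's algebra used the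
good-place hypotheses except the final scalar step and the harmless rescaling `u ↦ 2u`, which only needs `|2|_v ≤ 1` (`valued_two_le_one`).
* §1 `valued_mul_le_of_neg_tests` — negated scalar tests ⟹ `|2|_w·|δ|_w·|c_w|_w ≤ max(|δ|_w,1)·exp(e(w|v)(N − d))`.
* §2 HEAD **`valued_entry_mul_le_of_forall_test`** — the SAME binders as ★ §3's head minus `hunr h2w hδw` ⟹ the entrywise general-place bound for all `a b : Fin 2`.
HONEST LABEL.  Count-neutral helper; closes no socket by itself; `HC_CM` is proved only modulo the 7 printed citations (2 remaining named inputs: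
hLiu418 = `stmt-HodgeConjecture-24832`, h413 = `stmt-HodgeConjecture-24833`) until rung 0 closes.

## References
* [Shimura1997] G. Shimura, *Euler products and Eisenstein series*, CBMS 93 (1997): §18.4 Prop. 18.14 (support of Fourier coefficients in a dual lattice).
* [Tate1950] J. Tate, thesis (1950), in Cassels–Fröhlich (1967) Ch. XV: §2.2 (conductor of `ψ`, dual lattices under `ψ(xy)`).
* [BushnellHenniart2006] C. J. Bushnell, G. Henniart, *The local Langlands conjecture for GL(2)*, Grundlehren 335 (2006): §1.7.
* [WeilBNT1967] A. Weil, *Basic Number Theory* (1967): Ch. VIII §4 (local trace and duality; the different).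
-/

set_option autoImplicit false
-- the mandated namespace repeats the single-problem summit's segment (`HodgeConjecture.HodgeConjecture`)
set_option linter.dupNamespace false

noncomputable section

open scoped Matrix NNReal WithZero
open NumberField IsDedekindDomain Matrix
open Literature.NumberTheory.Automorphic Literature.NumberTheory.Automorphic.UnitaryGroup Literature.NumberTheory.GaloisRepresentations
open Literature.NumberTheory.GelbartRogawski1991 Literature.NumberTheory.GelbartRogawski1991.GRConstruction
open Literature.NumberTheory.GelbartRogawski1991.UnitaryDualPair
open Summit.HodgeConjecture.HodgeConjecture.Cruxes.HLiu418.K2LiuKindOneLineCharacterReading (invOf_two_eq_toLocalRing algebraMap_localRing_apply)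
open Summit.HodgeConjecture.HodgeConjecture.Cruxes.HLiu418.K2LiuKindOneLineCharacterBoundTwo

namespace Summit.HodgeConjecture.HodgeConjecture.Cruxes.HLiu418.K2LiuKindOneLineCharacterBoundTwoGeneral

variable (L : Type) [Field L] [NumberField L] [IsCMField L] (v : HeightOneSpectrum (𝓞 (Fp L)))

/-! ## §1 From the negated scalar tests to the general-place scalar bound

(P-supp-lat) consumer LH4-p18 (g3) 2026-09-05T00:01:54Z «(i) PLEASE»: (lat-c) `exists_latticeLetter_of_isOpen` reads ★ §3 at the cofinitely many good places and THIS
file at the finitely many bad ones, absorbing the unit defects `|2|_w·|δ|_w` (left) and `max(|δ|_w, 1)`, `e(w|v)` (right) into its free local exponent `δ w`.  Same four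
`htest··` binders as ★ (ρ3) §3; the hypotheses `hunr`, `h2w`, `hδw` are GONE: the off-diagonal readings are pure algebra, and the diagonal rescaling `u ↦ 2u` only needs `|2|_v ≤ 1`. -/

/-- from the two scalar tests in the NEGATED form `ψ(−u·τ c) = ψ(−u·τ(δ̃ c)) = 1` (`|u|_v ≤ exp(−N)`) to the GENERAL-place bound
`|2|_w·|δ|_w·|c_w|_w ≤ max(|δ|_w, 1)·exp(e(w|v)·(N − d))` (★ (ρ3) §1 `valued_mul_le_of_forall_addChar_trace_eq_one` after `u ↦ −u`). [cite: Tate1950, §2.2] [cite: BushnellHenniart2006, §1.7] -/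
theorem valued_mul_le_of_neg_tests {ψ : AddChar (v.adicCompletion (Fp L)) Circle} {d : ℤ} (hψ : ψ.HasConductorExp d)
    {τ : LocalRing L v → v.adicCompletion (Fp L)} (hτ : ∀ r, toLocalRing L v (τ r) = r + conjLocal L (IsCMField.complexConj L) v r)
    (hτs : ∀ (z : v.adicCompletion (Fp L)) (r : LocalRing L v), τ (toLocalRing L v z * r) = z * τ r)
    (w : UnitaryGroup.PlacesOver L v) (c : LocalRing L v) (N : ℤ)
    (h : ∀ u : v.adicCompletion (Fp L), Valued.v u ≤ WithZero.exp (-N) →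
      ψ (-(u * τ c)) = 1 ∧ ψ (-(u * τ (algebraMap L (LocalRing L v) (imagUnit L) * c))) = 1) :
    Valued.v ((2 : L) : w.1.adicCompletion L) * Valued.v ((imagUnit L : L) : w.1.adicCompletion L) * Valued.v (c w) ≤
      max (Valued.v ((imagUnit L : L) : w.1.adicCompletion L)) 1 * WithZero.exp ((v.asIdeal.ramificationIdx' w.1.asIdeal : ℤ) * (N - d)) := by
  refine valued_mul_le_of_forall_addChar_trace_eq_one L v hψ hτ hτs c N (fun u hu => ?_) (fun u hu => ?_) w
  · have h1 := (h (-u) (by rwa [Valuation.map_neg])).1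
    rw [hτs]
    rwa [neg_mul, neg_neg] at h1
  · have h2 := (h (-u) (by rwa [Valuation.map_neg])).2
    rw [hτs]
    rwa [neg_mul, neg_neg] at h2

/-! ## §2 The entrywise bound at `n = 2` at a GENERAL place `w ∣ v` (split ∕ inert ∕ RAMIFIED; `|2|_w`, `|δ|_w` arbitrary) -/

omit [IsCMField L] in
/-- `|2|_v ≤ 1` in `L⁺_v` (an integer; ultrametric inequality on `1 + 1`). [folklore] -/
theorem valued_two_le_one : Valued.v (2 : v.adicCompletion (Fp L)) ≤ 1 := by
  rw [show (2 : v.adicCompletion (Fp L)) = 1 + 1 by norm_num]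
  refine (Valuation.map_add _ _ _).trans ?_
  rw [Valuation.map_one, max_self]

/-- **THE ENTRYWISE BOUND AT `n = 2`, GENERAL PLACE (brick (ρ3) EDITION 2).**  K2Lit CM frame `L ∕ L⁺`, `v` ANY finite place of `L⁺` (possibly ramified in `L`), `w ∣ v` ANY place
over it (no condition on `|2|_w`, `|δ|_w`, `δ = imagUnit L`), `ψ` an additive character of `L⁺_v` of conductor exponent `d`, `τ` a local trace (`hτ hτadd hτs`), `G = diag(ι_v g₀, ι_v g₁)`
(`gᵢ ≠ 0`), `S ∈ M₂(L)` a `G`-skew Fourier index.  IF the character `X ↦ ψ(τ(−⅟2·tr((S⊗1)·X)))` is trivial on the four families of ELEMENTARY SKEW TEST MATRICES of depth `N` (the SAME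
binders `htest01 htest10 htest00 htest11` as ★ (ρ3) §3 `K2LiuKindOneLineCharacterBoundTwo.valued_entry_le_exp_of_forall_test`, token for token), THEN every entry satisfies
**`|2|_w · |δ|_w · |S_{ab}|_w ≤ max(|δ|_w, 1) · exp(e(w|v)·(N − d))`** — the off-diagonal readings are the algebra of ★ §3 verbatim (`g_a·ι_v g_a⁻¹ = 1`), the diagonal ones rescale
`u ↦ 2u` inside the ball by `|2|_v ≤ 1`, and the scalar engine is ★ §1 `valued_mul_le_of_forall_addChar_trace_eq_one` (ramification index in the exponent, no inverse different).
At a good place (`e = 1`, `|2|_w = |δ|_w = 1`) this is ★ §3 on the nose. [cite: Shimura1997, §18.4 Prop. 18.14] [cite: Tate1950, §2.2] [cite: BushnellHenniart2006, §1.7] [cite: WeilBNT1967, Ch. VIII §4] -/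
theorem valued_entry_mul_le_of_forall_test {ψ : AddChar (v.adicCompletion (Fp L)) Circle} {d : ℤ} (hψ : ψ.HasConductorExp d)
    {τ : LocalRing L v → v.adicCompletion (Fp L)} (hτ : ∀ r, toLocalRing L v (τ r) = r + conjLocal L (IsCMField.complexConj L) v r)
    (hτadd : ∀ r r', τ (r + r') = τ r + τ r')
    (hτs : ∀ (z : v.adicCompletion (Fp L)) (r : LocalRing L v), τ (toLocalRing L v z * r) = z * τ r)
    (w : UnitaryGroup.PlacesOver L v)
    (G : Matrix (Fin 2) (Fin 2) (LocalRing L v)) (hG01 : G 0 1 = 0) (hG10 : G 1 0 = 0)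
    {g₀ g₁ : v.adicCompletion (Fp L)} (hg₀ : g₀ ≠ 0) (hg₁ : g₁ ≠ 0) (hG00 : G 0 0 = toLocalRing L v g₀) (hG11 : G 1 1 = toLocalRing L v g₁)
    (S : Matrix (Fin 2) (Fin 2) L)
    (hS : ((S.map (algebraMap L (LocalRing L v))).map (conjLocal L (IsCMField.complexConj L) v))ᵀ * G + G * S.map (algebraMap L (LocalRing L v)) = 0)
    (N : ℤ)
    (htest01 : ∀ u : v.adicCompletion (Fp L), Valued.v u ≤ WithZero.exp (-N) → ∀ y : LocalRing L v, (y = 1 ∨ y = algebraMap L (LocalRing L v) (imagUnit L)) →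
      ψ (τ (-(⅟(2 : LocalRing L v) * Matrix.trace (S.map (algebraMap L (LocalRing L v)) *
        !![0, toLocalRing L v u * y; -(G 0 0 * toLocalRing L v g₁⁻¹ * conjLocal L (IsCMField.complexConj L) v (toLocalRing L v u * y)), 0])))) = 1)
    (htest10 : ∀ u : v.adicCompletion (Fp L), Valued.v u ≤ WithZero.exp (-N) → ∀ y : LocalRing L v, (y = 1 ∨ y = algebraMap L (LocalRing L v) (imagUnit L)) →
      ψ (τ (-(⅟(2 : LocalRing L v) * Matrix.trace (S.map (algebraMap L (LocalRing L v)) *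
        !![0, -(G 1 1 * toLocalRing L v g₀⁻¹ * conjLocal L (IsCMField.complexConj L) v (toLocalRing L v u * y)); toLocalRing L v u * y, 0])))) = 1)
    (htest00 : ∀ u : v.adicCompletion (Fp L), Valued.v u ≤ WithZero.exp (-N) →
      ψ (τ (-(⅟(2 : LocalRing L v) * Matrix.trace (S.map (algebraMap L (LocalRing L v)) *
        !![toLocalRing L v u * algebraMap L (LocalRing L v) (imagUnit L), 0; 0, 0])))) = 1)
    (htest11 : ∀ u : v.adicCompletion (Fp L), Valued.v u ≤ WithZero.exp (-N) →
      ψ (τ (-(⅟(2 : LocalRing L v) * Matrix.trace (S.map (algebraMap L (LocalRing L v)) *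
        !![0, 0; 0, toLocalRing L v u * algebraMap L (LocalRing L v) (imagUnit L)])))) = 1) :
    ∀ a b : Fin 2, Valued.v ((2 : L) : w.1.adicCompletion L) * Valued.v ((imagUnit L : L) : w.1.adicCompletion L) * Valued.v ((S a b : L) : w.1.adicCompletion L) ≤
      max (Valued.v ((imagUnit L : L) : w.1.adicCompletion L)) 1 * WithZero.exp ((v.asIdeal.ramificationIdx' w.1.asIdeal : ℤ) * (N - d)) := by
  haveI : Algebra.IsQuadraticExtension (Fp L) L := IsCMField.isQuadraticExtension L
  haveI : CharZero (v.adicCompletion (Fp L)) := charZero_of_injective_algebraMap (algebraMap (Fp L) (v.adicCompletion (Fp L))).injective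
  set σ := conjLocal L (IsCMField.complexConj L) v with hσdef
  set ι := toLocalRing L v with hιdef
  set δt := algebraMap L (LocalRing L v) (imagUnit L) with hδt
  set S' := S.map (algebraMap L (LocalRing L v)) with hS'
  -- the involution and the trace letters
  have hσσ : ∀ r : LocalRing L v, σ (σ r) = r := fun r => conjLocal_conjLocal (IsCMField.complexConj L) v (complexConj_imagUnit L) (imagUnit_ne_zero L) r
  have hσι : ∀ z, σ (ι z) = ι z := fun z => by rw [hσdef, hιdef, conjLocal_toLocalRing]
  have hτσ : ∀ r : LocalRing L v, τ (σ r) = τ r := fun r => toLocalRing_injective L v (by rw [← hιdef, hτ, hτ, hσσ, add_comm])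
  have hτhalf : ∀ t : LocalRing L v, τ (-(⅟(2 : LocalRing L v) * t)) = -(2⁻¹ * τ t) := fun t => by
    rw [invOf_two_eq_toLocalRing, ← hιdef, ← neg_mul, ← map_neg ι, hτs, neg_mul]
  have h2ne : (2 : v.adicCompletion (Fp L)) ≠ 0 := two_ne_zero
  -- the skew relations of the index; diagonal inverses; entries at `w`
  obtain ⟨hs10, hs01, hs00, hs11⟩ := skew_entries σ hG01 hG10 hS
  have hg1u : G 1 1 * ι g₁⁻¹ = 1 := by rw [hG11, ← map_mul, mul_inv_cancel₀ hg₁, map_one]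
  have hg0u : G 0 0 * ι g₀⁻¹ = 1 := by rw [hG00, ← map_mul, mul_inv_cancel₀ hg₀, map_one]
  have hG0σ : σ (G 0 0) = G 0 0 := by rw [hG00]; exact hσι g₀
  have hG1σ : σ (G 1 1) = G 1 1 := by rw [hG11]; exact hσι g₁
  have hentry : ∀ a b, Valued.v ((S a b : L) : w.1.adicCompletion L) = Valued.v (S' a b w) := fun a b => by
    rw [hS', Matrix.map_apply, algebraMap_localRing_apply]
  have harg : ∀ t : v.adicCompletion (Fp L), -(2⁻¹ * (2 * t)) = -t := fun t => by rw [← mul_assoc, inv_mul_cancel₀ h2ne, one_mul]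
  -- OFF-DIAGONAL (1,0): the test `X₀₁(ι u · y)` reads `ψ(−u·τ(y·S'₁₀))` (pure algebra, as in ★ §3)
  have hoff10 : ∀ (u : v.adicCompletion (Fp L)) (y : LocalRing L v),
      ψ (τ (-(⅟(2 : LocalRing L v) * Matrix.trace (S' * !![0, ι u * y; -(G 0 0 * ι g₁⁻¹ * σ (ι u * y)), 0])))) = ψ (-(u * τ (y * S' 1 0))) := by
    intro u y
    have hsw : S' 0 1 * -(G 0 0 * ι g₁⁻¹ * σ (ι u * y)) = σ (-(σ (S' 0 1) * G 0 0 * ι g₁⁻¹ * (ι u * y))) := by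
      simp only [map_neg, map_mul, hσσ, hG0σ, hσι]
      ring
    have hsecond : τ (S' 0 1 * -(G 0 0 * ι g₁⁻¹ * σ (ι u * y))) = τ (S' 1 0 * (ι u * y)) := by
      rw [hsw, hτσ]
      congr 1
      linear_combination (-(ι g₁⁻¹ * (ι u * y))) * hs10 + (S' 1 0 * (ι u * y)) * hg1u
    rw [(trace_mul_test S' _ _).1, hτhalf, hτadd, hsecond, ← two_mul, show S' 1 0 * (ι u * y) = ι u * (y * S' 1 0) by ring, hτs, harg]
  -- OFF-DIAGONAL (0,1): the test `X₁₀(ι u · y)` reads `ψ(−u·τ(y·S'₀₁))`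
  have hoff01 : ∀ (u : v.adicCompletion (Fp L)) (y : LocalRing L v),
      ψ (τ (-(⅟(2 : LocalRing L v) * Matrix.trace (S' * !![0, -(G 1 1 * ι g₀⁻¹ * σ (ι u * y)); ι u * y, 0])))) = ψ (-(u * τ (y * S' 0 1))) := by
    intro u y
    have hsw : S' 1 0 * -(G 1 1 * ι g₀⁻¹ * σ (ι u * y)) = σ (-(σ (S' 1 0) * G 1 1 * ι g₀⁻¹ * (ι u * y))) := by
      simp only [map_neg, map_mul, hσσ, hG1σ, hσι]
      ring
    have hfirst : τ (S' 1 0 * -(G 1 1 * ι g₀⁻¹ * σ (ι u * y))) = τ (S' 0 1 * (ι u * y)) := by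
      rw [hsw, hτσ]
      congr 1
      linear_combination (-(ι g₀⁻¹ * (ι u * y))) * hs01 + (S' 0 1 * (ι u * y)) * hg0u
    rw [(trace_mul_test S' _ _).1, hτhalf, hτadd, hfirst, ← two_mul, show S' 0 1 * (ι u * y) = ι u * (y * S' 0 1) by ring, hτs, harg]
  -- DIAGONAL: `τ(S'_{aa}) = 0` for free (skew diagonal entries are anti-invariant), and the test `ι u·δ̃·E_{aa}` reads `ψ(−(2⁻¹u)·τ(δ̃ S'_{aa}))`
  have hdiag_free : ∀ {x : LocalRing L v}, σ x * G 0 0 + G 0 0 * x = 0 ∨ σ x * G 1 1 + G 1 1 * x = 0 → ∀ u : v.adicCompletion (Fp L), ψ (-(u * τ x)) = 1 := by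
    intro x hx u
    have hσx : σ x = -x := by
      rcases hx with hx | hx
      · linear_combination (ι g₀⁻¹) * hx - (σ x + x) * hg0u
      · linear_combination (ι g₁⁻¹) * hx - (σ x + x) * hg1u
    have hτx : τ x = 0 := by
      refine toLocalRing_injective L v ?_
      rw [← hιdef, hτ, hσx, add_neg_cancel, map_zero]
    rw [hτx, mul_zero, neg_zero, AddChar.map_zero_eq_one]
  have hdiag00 : ∀ u : v.adicCompletion (Fp L),
      ψ (τ (-(⅟(2 : LocalRing L v) * Matrix.trace (S' * !![ι u * δt, 0; 0, 0])))) = ψ (-((2⁻¹ * u) * τ (δt * S' 0 0))) := fun u => by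
    rw [(trace_mul_test S' (ι u * δt) 0).2.1, hτhalf, show S' 0 0 * (ι u * δt) = ι u * (δt * S' 0 0) by ring, hτs, mul_assoc]
  have hdiag11 : ∀ u : v.adicCompletion (Fp L),
      ψ (τ (-(⅟(2 : LocalRing L v) * Matrix.trace (S' * !![0, 0; 0, ι u * δt])))) = ψ (-((2⁻¹ * u) * τ (δt * S' 1 1))) := fun u => by
    rw [(trace_mul_test S' (ι u * δt) 0).2.2, hτhalf, show S' 1 1 * (ι u * δt) = ι u * (δt * S' 1 1) by ring, hτs, mul_assoc]
  -- rescaling `u ↦ 2u` keeps the ball at EVERY place (`|2|_v ≤ 1`)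
  have h2v : Valued.v (2 : v.adicCompletion (Fp L)) ≤ 1 := valued_two_le_one L v
  have hball2 : ∀ u : v.adicCompletion (Fp L), Valued.v u ≤ WithZero.exp (-N) → Valued.v (2 * u) ≤ WithZero.exp (-N) := fun u hu => by
    rw [Valuation.map_mul]
    exact ((mul_le_mul_left h2v _).trans_eq (one_mul _)).trans hu
  have h2inv : ∀ u : v.adicCompletion (Fp L), 2⁻¹ * (2 * u) = u := fun u => by rw [← mul_assoc, inv_mul_cancel₀ h2ne, one_mul]
  -- assemble per entry with the GENERAL-place scalar engine
  intro a b
  rw [hentry]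
  fin_cases a <;> fin_cases b
  · -- (0,0)
    refine valued_mul_le_of_neg_tests L v hψ hτ hτs w (S' 0 0) N fun u hu => ⟨hdiag_free (Or.inl hs00) u, ?_⟩
    have h := htest00 (2 * u) (hball2 u hu)
    rwa [hdiag00, h2inv] at h
  · -- (0,1)
    refine valued_mul_le_of_neg_tests L v hψ hτ hτs w (S' 0 1) N fun u hu => ⟨?_, ?_⟩
    · have h := htest10 u hu 1 (Or.inl rfl)
      rwa [hoff01 u 1, one_mul] at h
    · have h := htest10 u hu δt (Or.inr rfl)
      rwa [hoff01 u δt] at h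
  · -- (1,0)
    refine valued_mul_le_of_neg_tests L v hψ hτ hτs w (S' 1 0) N fun u hu => ⟨?_, ?_⟩
    · have h := htest01 u hu 1 (Or.inl rfl)
      rwa [hoff10 u 1, one_mul] at h
    · have h := htest01 u hu δt (Or.inr rfl)
      rwa [hoff10 u δt] at h
  · -- (1,1)
    refine valued_mul_le_of_neg_tests L v hψ hτ hτs w (S' 1 1) N fun u hu => ⟨hdiag_free (Or.inr hs11) u, ?_⟩
    have h := htest11 (2 * u) (hball2 u hu)
    rwa [hdiag11, h2inv] at h

end Summit.HodgeConjecture.HodgeConjecture.Cruxes.HLiu418.K2LiuKindOneLineCharacterBoundTwoGeneral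

end
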